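import Summits.BirchSwinnertonDyer.BirchSwinnertonDyer.Theorems.KolyvaginDepthDoorDepthRow389a1
import Summits.BirchSwinnertonDyer.BirchSwinnertonDyer.Theorems.Rank1ResidualIntModelReduction
import Literature.NumberTheory.EllipticCurves.SemistableModPImageFiveProofs
import Literature.NumberTheory.EllipticCurves.HeegnerHypothesisKroneckerProofs
import Literature.NumberTheory.EllipticCurves.HeegnerPointsImaginaryQuadraticProofs
import Literature.NumberTheory.QuadraticFields.RingClassNumberFormula
import Literature.NumberTheory.QuadraticFields.FundamentalDiscriminant
import Literature.NumberTheory.DiophantineGeometry.LocalReductionIsSemistableAtProofs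
import Literature.NumberTheory.DiophantineGeometry.GeneralizedFermatTwoPowerCoefficientFreySaitoProofs
import HarnessLib

/-!
# Route `KolyvaginDepthDoor` — the DEPTH-TABLE ROW KIT: every side condition of a row certificate
# read off an integer model and decided in the kernel (crux `KolyvaginDepthSupply`, stmt-BirchSwinnertonDyer-21765)

Helper file (`--supports stmt-BirchSwinnertonDyer-21765 --as helper`); it closes nothing and BSD is
not proved by it. HONEST FRAMING: per-curve certificate FORMAT; the only non-decidable inputs of a
row are Kolyvagin's structure theorem (Kolyvagin 1991 Thm. 4 = W. Zhang 2014 Thm. 11.2 (i), the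
route's support item `KolyvaginStructure`, hypothesis `hF`) and the COMPUTED bit `c_1(ℓ) ≠ 0` (the
output of the route's DEPTH-TABLE instrument, Jetchev–Lauter–Stein arXiv:0707.0032 §3.6).

The route's cheapest falsifier / instrument is the DEPTH TABLE over the 18 Cremona rank-2 curves of
conductor `≤ 1000`. The row certificate `depthRow_certificate_of_two_le_rank`
(`KolyvaginDepthDoorDepthRow389a1`) turns ONE non-zero first derived class `c_M(ℓ) ≠ 0` at
admissible `(p, K, ℓ, M)` into `corank_{ℤ_p} Ш(E)[p^∞] = 0 ∧ rank_ℤ E(ℚ) = 2 ∧ s_p(E) = 2 ∧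
s_p(E^{(d_K)}) = 1`, but leaves the admissibility of `(p, K, ℓ)` — `p ∤ N_E`, `ρ̄_{E,p}` onto,
the Heegner hypothesis for `(N_E, K)`, `ℓ` a Kolyvagin prime, `1 ≤ M(ℓ)` — as hypotheses. This file
shows that for a curve given by an integer equation `E₀` with `integralModelInt W = E₀` EVERY ONE
of them is a decidable statement about `E₀`, proved here once and for all from tree theorems:

* `dvd_Δ_of_dvd_conductorNorm`, `not_dvd_conductorNorm_of_not_dvd_Δ` — primes of `N_E` divide
  `Δ(E₀)` (Silverman VII.5.1 (a); tree `hasGoodReductionAtPrime_of_not_dvd`,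
  `dvd_conductorNorm_iff_not_hasGoodReductionAtPrime`), so `p ∤ Δ(E₀) ⇒ p ∤ N_E` and
* `satisfiesHeegnerHypothesis_conductorNorm_of_intModel` — the Heegner hypothesis for `N_E` follows
  from Kronecker symbols `(d_K/q) = 1` at the primes `q ∣ Δ(E₀)` (decomposition law, tree
  `satisfiesHeegnerHypothesis_iff_kronecker`) — NO computation of `N_E` is needed;
* `isSemistable_of_intModel_of_isCoprime` — `gcd(c₄(E₀), Δ(E₀)) = 1 ⇒` semistable (Silverman
  VII.5.1; tree `isSemistable_baseChange_of_isCoprime`);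
* `hasSurjectiveModNGaloisRep_of_intModel_certificate` — **`ρ̄_{E,p}` ONTO from decidable data**:
  semistable + one good prime `q ≠ p` at which `X² − a_q X + q` has no root mod `p` (Mazur 1978
  Prop. 6.3 (1): `E[p]` irreducible, tree `IntModel.hasIrreducibleModPGaloisRep_of_intModel_of_noroot`)
  ⇒ onto, by Serre 1972 §5.4 Prop. 21 for semistable curves — the TREE THEOREM
  `hasSurjectiveModNGaloisRep_of_hasIrreducibleModPGaloisRep_of_isSemistable`
  (`SemistableModPImageFiveProofs`, Serre/Edixhoven, proved in the tree, no named fact);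
* `goodOrdinary_of_intModel_certificate` — `p ∤ Δ(E₀)`, `p ∤ a_p = p + 1 − #(E₀ mod p)(𝔽_p)`;
* `isKolyvaginPrime_of_intModel_certificate` — `Zhang2014.IsKolyvaginPrime N_E W K p ℓ` and
  `(1 : ℕ∞) ≤ levelIndex W p ℓ` from: `ℓ` odd prime, `ℓ ∤ Δ(E₀) d_K`, `ℓ ≠ p`, `(d_K/ℓ) = −1`
  (inert: tree `RingClass.isPrime_span_natCast_iff_jacobiSym_eq_neg_one`, Cox Prop. 5.16),
  `p ∣ ℓ + 1`, `p ∣ a_ℓ` (point count);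
* `depthRow_of_intModel_certificate` — **the assembled row**: all of the above + a kernel rank
  certificate `2 ≤ rank_ℤ E(ℚ)` + `hF` + the bit `c_1(ℓ) ≠ 0` ⇒ `t_p = 0 ∧ rank = 2 ∧ s_p = 2 ∧
  s_p(E^{(d_K)}) = 1`;
* `forall_prime_dvd_of_natAbs_eq_pow(_mul_pow)` — bookkeeping of the prime divisors of `Δ`;
* `exists_isImaginaryQuadratic_discr_eq` and `exists_field_neg8`, …, `exists_field_neg111` — the
  field binder of every row is inhabited (Marcus Ch. 2 Thm. 1; tree
  `Quadratic.exists_numberField_discr_eq`, `isImaginaryQuadratic_iff_discr_neg`), for the ten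
  discriminants `−8, −19, −23, −31, −39, −51, −52, −67, −83, −111` used by the row files
  `KolyvaginDepthDoorDepthTableRows*.lean`; for `d_K = −7` this is already the tree's
  `Rank2Observatory.exists_heegnerField_5077a1` (`Rank2ObservatoryHeegnerField`, not re-stated).

Point counts `#(E₀ mod ℓ)(𝔽_ℓ) = n` are consumed in the shape produced by the tree's `ℕ`-arithmetic
Euler certificate `PointCountNat.natCard_point_map_eq` (`decide +kernel`, no `native_decide`).

References: [Kolyvagin1991MathAnn] §2 Thm. 4; [WZhang2014] Thm. 11.2 (i), Notations (xii);
[Serre1972] §5.4 Prop. 21; [Mazur1978] §6 Prop. 6.3 (1); [GrossLMS1991] §1, §3 (3.1)–(3.3);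
[JetchevLauterStein2009] arXiv:0707.0032 §3.6; [SilvermanAEC2009] VII.5 Prop. 5.1, VIII.8;
[Marcus1977] Ch. 2 Thm. 1, Ch. 3 Thm. 25; [Cox2013] §5.B Prop. 5.16.
-/

set_option linter.dupNamespace false

noncomputable section

open scoped Classical NumberField

namespace Summit.BirchSwinnertonDyer.BirchSwinnertonDyer.Theorems.KolyvaginDepthDoor

open Literature.NumberTheory.EllipticCurves Literature.NumberTheory.EllipticCurves.ModularForms
  WeierstrassCurve
open Summit.BirchSwinnertonDyer.BirchSwinnertonDyer.Rank1Residual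


/-! ## §0 Generic certificates read off an integer model

For a globally minimal `W/ℚ` with integral model `integralModelInt W = E₀` (for a literal integer
equation `E₀ ⊗ ℚ` this is `IntModel.integralModelInt_eq_of_map_eq`), every side condition of a
depth-table row is a decidable statement about `E₀`. -/

section Generic

variable {W : WeierstrassCurve ℚ} [W.IsElliptic] [W.IsGloballyMinimal] {E₀ : WeierstrassCurve ℤ}
  (hI : integralModelInt W = E₀)
include hI

omit [W.IsElliptic] in
/-- A globally minimal `W/ℚ` IS its integral model pushed to `ℚ`: `W = E₀ ⊗ ℚ` (Silverman, AEC VIII.8). [folklore] -/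
theorem eq_baseChange_of_intModel : W = E₀.baseChange ℚ := by
  rw [WeierstrassCurve.baseChange, algebraMap_int_eq, ← hI, map_integralModelInt]

/-- A prime of the conductor divides the minimal discriminant `Δ(E₀)` (bad reduction ⇒ `q ∣ Δ_min`;
Silverman, AEC VII.5 Prop. 5.1 (a)). [cite: SilvermanAEC2009, VII.5 Prop. 5.1 (a)] -/
theorem dvd_Δ_of_dvd_conductorNorm {q : ℕ} (hq : q.Prime) (hqN : q ∣ W.conductorNorm ℤ) :
    (q : ℤ) ∣ E₀.Δ := by
  haveI := Fact.mk hq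
  by_contra h
  exact (W.dvd_conductorNorm_iff_not_hasGoodReductionAtPrime q).mp hqN
    (hasGoodReductionAtPrime_of_not_dvd W q (by rwa [IntModel.minimalDiscriminantInt_eq hI]))

/-- `q ∤ Δ(E₀)` ⇒ `q ∤ N_E` (good reduction at `q`). [cite: SilvermanAEC2009, VII.5 Prop. 5.1 (a)] -/
theorem not_dvd_conductorNorm_of_not_dvd_Δ {q : ℕ} (hq : q.Prime) (hqΔ : ¬ (q : ℤ) ∣ E₀.Δ) :
    ¬ q ∣ W.conductorNorm ℤ :=
  fun h ↦ hqΔ (dvd_Δ_of_dvd_conductorNorm hI hq h)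

/-- **The Heegner hypothesis for `N_E` read off `Δ(E₀)`** (decomposition law, Marcus Ch. 3 Thm. 25):
for a quadratic `K` with `d_K = D`, if every prime `q ∣ Δ(E₀)` has `(D/q) = 1` (`D ≡ 1 (mod 8)` at
`q = 2`), then every prime of `N_E` splits in `K`. [cite: GrossLMS1991, §1 (p. 235)]
[cite: Marcus1977, Ch. 3 Thm. 25] -/
theorem satisfiesHeegnerHypothesis_conductorNorm_of_intModel (K : Type) [Field K] [NumberField K]
    (h2 : Module.finrank ℚ K = 2) {D : ℤ} (hD : NumberField.discr K = D)
    (hH : ∀ q : ℕ, q.Prime → (q : ℤ) ∣ E₀.Δ → (q = 2 → D % 8 = 1) ∧ (q ≠ 2 → jacobiSym D q = 1)) :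
    SatisfiesHeegnerHypothesis (W.conductorNorm ℤ) K := by
  rw [satisfiesHeegnerHypothesis_iff_kronecker _ K h2, hD]
  exact fun q hq hqN ↦ hH q hq (dvd_Δ_of_dvd_conductorNorm hI hq hqN)

/-- **Semistability read off the integer model**: `gcd(c₄(E₀), Δ(E₀)) = 1` ⇒ `W` is semistable
(at every prime one of `Δ`, `c₄` is a unit: Silverman, AEC VII.5 Prop. 5.1 (a),(b) with VII.1 Rem. 1.1).
[cite: SilvermanAEC2009, VII.5 Prop. 5.1] -/
theorem isSemistable_of_intModel_of_isCoprime (hcop : IsCoprime E₀.c₄ E₀.Δ) :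
    W.IsSemistable (𝓞 ℚ) := by
  have hΔ : E₀.Δ ≠ 0 := by
    rw [← IntModel.minimalDiscriminantInt_eq hI]
    exact minimalDiscriminantInt_ne_zero W
  have h : (E₀.baseChange ℚ).IsSemistable ℤ := isSemistable_baseChange_of_isCoprime E₀ hΔ hcop
  rw [← eq_baseChange_of_intModel hI] at h
  exact Literature.NumberTheory.DiophantineGeometry.isSemistable_ringOfIntegers_of_isSemistable_int W h

/-- **`ρ̄_{E,p}` SURJECTIVE from the integer model** (Serre 1972, Prop. 21 for semistable curves —
the tree theorem `hasSurjectiveModNGaloisRep_of_hasIrreducibleModPGaloisRep_of_isSemistable` — fed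
by Mazur's Frobenius no-root certificate for the irreducibility of `E[p]`): `gcd(c₄, Δ) = 1`, a good
prime `q ∤ Δ(E₀)`, `q ≠ p`, with `#(E₀ mod q)(𝔽_q) = n` and `X² − (q + 1 − n)X + q` root-free
modulo `p` ⇒ `ρ̄_{E,p} : Γ_ℚ ↠ GL₂(𝔽_p)`. [cite: Serre1972, §5.4 Prop. 21]
[cite: Mazur1978, §6 Prop. 6.3 (1) (p. 153)] -/
theorem hasSurjectiveModNGaloisRep_of_intModel_certificate (hcop : IsCoprime E₀.c₄ E₀.Δ)
    (p q : ℕ) [Fact p.Prime] [Fact q.Prime] (hqp : q ≠ p) (hqΔ : ¬ (q : ℤ) ∣ E₀.Δ) {n : ℕ}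
    (hcard : Nat.card ((E₀.map (Int.castRingHom (ZMod q))).toAffine.Point) = n)
    (hnoroot : ∀ t : ZMod p, t ^ 2 - (((q : ℤ) + 1 - n : ℤ) : ZMod p) * t + (q : ZMod p) ≠ 0) :
    W.HasSurjectiveModNGaloisRep p :=
  W.hasSurjectiveModNGaloisRep_of_hasIrreducibleModPGaloisRep_of_isSemistable
    (isSemistable_of_intModel_of_isCoprime hI hcop) p
    (IntModel.hasIrreducibleModPGaloisRep_of_intModel_of_noroot hI p q hqp hqΔ hcard hnoroot)

omit [W.IsElliptic] in
/-- **Good ORDINARY reduction at `p` from the integer model**: `p ∤ Δ(E₀)` and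
`#(E₀ mod p)(𝔽_p) = n` with `p ∤ p + 1 − n` (`a_p ≢ 0 (mod p)`). [cite: SilvermanAEC2009, VII.5 Prop. 5.1 (a) and V.2] -/
theorem goodOrdinary_of_intModel_certificate (p : ℕ) [Fact p.Prime] (hpΔ : ¬ (p : ℤ) ∣ E₀.Δ)
    {n : ℕ} (hcard : Nat.card ((E₀.map (Int.castRingHom (ZMod p))).toAffine.Point) = n)
    (hord : ¬ (p : ℤ) ∣ (p : ℤ) + 1 - n) :
    W.HasGoodReductionAtPrime p ∧ ¬ (p : ℤ) ∣ W.frobeniusTrace p := by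
  refine ⟨hasGoodReductionAtPrime_of_not_dvd W p ?_, ?_⟩
  · rwa [IntModel.minimalDiscriminantInt_eq hI]
  · rwa [IntModel.frobeniusTrace_eq hI hcard]

/-- **A Kolyvagin prime read off the integer model** (Zhang 2014, Notations (xii): `ℓ ∤ N D p`,
`ℓ` inert in `K`, `M(ℓ) = min(v_p(ℓ+1), v_p(a_ℓ)) ≥ 1`): for a quadratic `K` with `d_K = D`, an odd
prime `ℓ ∤ Δ(E₀)` (so `ℓ ∤ N_E`), `ℓ ∤ D`, `ℓ ≠ p`, `(D/ℓ) = −1` (inert, Cox Prop. 5.16),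
`p ∣ ℓ + 1` and `p ∣ a_ℓ = ℓ + 1 − #(E₀ mod ℓ)(𝔽_ℓ)`; and then `1 ≤ M(ℓ)` as
`(1 : ℕ∞) ≤ levelIndex W p ℓ`. [cite: WZhang2014, Notations (xii)] [cite: Cox2013, §5.B Prop. 5.16] -/
theorem isKolyvaginPrime_of_intModel_certificate (p : ℕ) [Fact p.Prime]
    (K : Type) [Field K] [NumberField K] (h2 : Module.finrank ℚ K = 2) {D : ℤ}
    (hD : NumberField.discr K = D) (ℓ : ℕ) (hℓ : ℓ.Prime) (hℓ2 : ℓ ≠ 2) (hℓΔ : ¬ (ℓ : ℤ) ∣ E₀.Δ)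
    (hℓD : ¬ (ℓ : ℤ) ∣ D) (hℓp : ℓ ≠ p) (hjac : jacobiSym D ℓ = -1) (hℓ1 : p ∣ ℓ + 1) {n : ℕ}
    (hcard : Nat.card ((E₀.map (Int.castRingHom (ZMod ℓ))).toAffine.Point) = n)
    (haℓ : (p : ℤ) ∣ (ℓ : ℤ) + 1 - n) :
    Zhang2014.IsKolyvaginPrime (W.conductorNorm ℤ) W K p ℓ ∧
      (1 : ℕ∞) ≤ Zhang2014.levelIndex W p ℓ := by
  have hidx : 1 ≤ Zhang2014.kolyvaginIndex W p ℓ := by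
    rw [Zhang2014.le_kolyvaginIndex_iff, pow_one, pow_one, IntModel.frobeniusTrace_eq hI hcard]
    exact ⟨hℓ1, haℓ⟩
  refine ⟨⟨hℓ, not_dvd_conductorNorm_of_not_dvd_Δ hI hℓ hℓΔ, by rwa [hD], hℓp, ?_, hidx⟩, ?_⟩
  · rw [Literature.NumberTheory.QuadraticFields.RingClass.isPrime_span_natCast_iff_jacobiSym_eq_neg_one
      h2 hℓ hℓ2, hD]
    exact hjac
  · rw [show (1 : ℕ∞) = ((1 : ℕ) : ℕ∞) from rfl, Zhang2014.natCast_le_levelIndex_iff]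
    intro q hq
    rw [hℓ.primeFactors, Finset.mem_singleton] at hq
    subst hq
    exact hidx

/-- **The depth-table ROW with concrete admissible data (modulo Kolyvagin 1991, Thm. 4 = `hF`).**
Inputs: a globally minimal elliptic `W/ℚ` with integral model `E₀` and a certified lower bound
`2 ≤ rank_ℤ E(ℚ)`; a prime `p ≥ 5`, `p ∤ Δ(E₀)` (good), with `ρ̄_{E,p}` onto; an imaginary
quadratic `K` of discriminant `D ∉ {−3, −4}`, `p ∤ D`, in which every prime of `Δ(E₀)` splits
(Heegner hypothesis for `N_E`); an odd prime `ℓ ∤ Δ(E₀) D`, `ℓ ≠ p`, `(D/ℓ) = −1`, `p ∣ ℓ + 1`,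
`p ∣ a_ℓ = ℓ + 1 − #(E₀ mod ℓ)(𝔽_ℓ)` (a Kolyvagin prime with `M(ℓ) ≥ 1`); a modular parametrisation
datum of level `N_E` and a Kolyvagin–Heegner datum `d` of conductor `ℓ`. OUTPUT: if the first derived
class at level `M = 1` does not vanish, `c_1(ℓ) ≠ 0`, then `corank_{ℤ_p} Ш(E)[p^∞] = 0`,
`rank_ℤ E(ℚ) = 2` (exactly), `corank Sel_{p^∞}(E/ℚ) = 2` and `corank Sel_{p^∞}(E^{(D)}/ℚ) = 1`
(`depthRow_certificate_of_two_le_rank`). Per-curve; conditional on `hF` and on the computed bit;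
BSD is not proved by it. [cite: Kolyvagin1991MathAnn, §2 Thm. 4]
[cite: WZhang2014, Thm. 11.2 (i) and Notations (xii)] [cite: JetchevLauterStein2009, §3.6 (arXiv:0707.0032)] -/
theorem depthRow_of_intModel_certificate
    (hF : Kolyvagin1991_selmerCorank_of_kolyvaginClass_ne_zero) (hr : 2 ≤ W.mordellWeilRank)
    (p : ℕ) [hp : Fact p.Prime] (h5 : 5 ≤ p) (hpΔ : ¬ (p : ℤ) ∣ E₀.Δ)
    (hsurj : W.HasSurjectiveModNGaloisRep p)
    (K : Type) [Field K] [NumberField K] (hK : IsImaginaryQuadratic K) {D : ℤ}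
    (hD : NumberField.discr K = D) (h3 : D ≠ -3) (h4 : D ≠ -4) (hpD : ¬ (p : ℤ) ∣ D)
    (hH : ∀ q : ℕ, q.Prime → (q : ℤ) ∣ E₀.Δ → (q = 2 → D % 8 = 1) ∧ (q ≠ 2 → jacobiSym D q = 1))
    (ℓ : ℕ) (hℓ : ℓ.Prime) (hℓ2 : ℓ ≠ 2) (hℓΔ : ¬ (ℓ : ℤ) ∣ E₀.Δ) (hℓD : ¬ (ℓ : ℤ) ∣ D)
    (hℓp : ℓ ≠ p) (hjac : jacobiSym D ℓ = -1) (hℓ1 : p ∣ ℓ + 1) {n : ℕ}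
    (hcard : Nat.card ((E₀.map (Int.castRingHom (ZMod ℓ))).toAffine.Point) = n)
    (haℓ : (p : ℤ) ∣ (ℓ : ℤ) + 1 - n)
    [NeZero (W.conductorNorm ℤ)] (Dt : ModularParametrizationData W (W.conductorNorm ℤ)) (β : ℤ)
    (ι : K →+* ℂ) (d : KolyvaginHeegnerData Dt β ι ℓ) (hne : d.kolyvaginClass hp.out 1 ≠ 0) :
    W.shaCorank p = 0 ∧ W.mordellWeilRank = 2 ∧ W.selmerCorank p = 2 ∧
      (W.quadraticTwist (D : ℚ)).selmerCorank p = 1 := by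
  obtain ⟨hkol, hlev⟩ := isKolyvaginPrime_of_intModel_certificate hI p K hK.1 hD ℓ hℓ hℓ2 hℓΔ hℓD
    hℓp hjac hℓ1 hcard haℓ
  have h := depthRow_certificate_of_two_le_rank hF W hr p h5 hsurj K hK (by rw [hD]; exact h3)
    (by rw [hD]; exact h4) (by rw [hD]; exact hpD)
    (not_dvd_conductorNorm_of_not_dvd_Δ hI hp.out hpΔ)
    (satisfiesHeegnerHypothesis_conductorNorm_of_intModel hI K hK.1 hD hH) Dt β ι ℓ hℓ hkol d 1
    le_rfl hlev hne
  rw [hD] at h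
  exact h

end Generic

/-- Prime-divisor bookkeeping: a property checked on the prime factors of `|Δ|` holds at every
prime `q ∣ Δ`. [folklore] -/
theorem forall_prime_dvd_of_forall_mem_primeFactors {Δ : ℤ} (hΔ : Δ ≠ 0) {P : ℕ → Prop}
    (h : ∀ q ∈ Δ.natAbs.primeFactors, P q) : ∀ q : ℕ, q.Prime → (q : ℤ) ∣ Δ → P q :=
  fun q hq hqd ↦ h q (Nat.mem_primeFactors.mpr ⟨hq, Int.natCast_dvd.mp hqd,
    Int.natAbs_ne_zero.mpr hΔ⟩)

/-- **Fields of prescribed discriminant exist**: for a negative fundamental discriminant `D` there is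
an imaginary quadratic number field `K` (a `Type`) with `d_K = D` (Marcus Ch. 2 Thm. 1; the tree's
`Quadratic.exists_numberField_discr_eq` and `isImaginaryQuadratic_iff_discr_neg`) — so the field
binder of every row below is inhabited. [cite: Marcus1977, Ch. 2 Thm. 1] -/
theorem exists_isImaginaryQuadratic_discr_eq {D : ℤ} (hneg : D < 0)
    (hD : (D % 4 = 1 ∧ Squarefree D ∧ D ≠ 1) ∨
      (4 ∣ D ∧ (D / 4 % 4 = 2 ∨ D / 4 % 4 = 3) ∧ Squarefree (D / 4))) :
    ∃ (K : Type) (_ : Field K) (_ : NumberField K), IsImaginaryQuadratic K ∧ NumberField.discr K = D := by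
  obtain ⟨K, _, _, hK2, hd⟩ := Literature.NumberTheory.QuadraticFields.Quadratic.exists_numberField_discr_eq hD
  exact ⟨K, _, _, isImaginaryQuadratic_iff_discr_neg.2 ⟨hK2, by rw [hd]; exact hneg⟩, hd⟩

/-- Prime divisors of `Δ` when `|Δ| = aⁱ` (`a` prime): only `a`. [folklore] -/
theorem forall_prime_dvd_of_natAbs_eq_pow {Δ : ℤ} {a i : ℕ} (h : Δ.natAbs = a ^ i) (ha : a.Prime)
    {P : ℕ → Prop} (hPa : P a) : ∀ q : ℕ, q.Prime → (q : ℤ) ∣ Δ → P q := by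
  intro q hq hqd
  have h1 : q ∣ a ^ i := h ▸ Int.natCast_dvd.mp hqd
  obtain rfl := (Nat.prime_dvd_prime_iff_eq hq ha).mp (hq.dvd_of_dvd_pow h1)
  exact hPa

/-- Prime divisors of `Δ` when `|Δ| = aⁱ bʲ` (`a`, `b` prime): only `a`, `b`. [folklore] -/
theorem forall_prime_dvd_of_natAbs_eq_pow_mul_pow {Δ : ℤ} {a i b j : ℕ}
    (h : Δ.natAbs = a ^ i * b ^ j) (ha : a.Prime) (hb : b.Prime) {P : ℕ → Prop} (hPa : P a)
    (hPb : P b) : ∀ q : ℕ, q.Prime → (q : ℤ) ∣ Δ → P q := by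
  intro q hq hqd
  have h1 : q ∣ a ^ i * b ^ j := h ▸ Int.natCast_dvd.mp hqd
  rcases (Nat.Prime.dvd_mul hq).mp h1 with h2 | h2
  · obtain rfl := (Nat.prime_dvd_prime_iff_eq hq ha).mp (hq.dvd_of_dvd_pow h2); exact hPa
  · obtain rfl := (Nat.prime_dvd_prime_iff_eq hq hb).mp (hq.dvd_of_dvd_pow h2); exact hPb


/-! ## The Heegner fields of the rows exist -/

/-- An imaginary quadratic field of discriminant `-8` exists (as a `Type`). [cite: Marcus1977, Ch. 2 Thm. 1] -/
theorem exists_field_neg8 :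
    ∃ (K : Type) (_ : Field K) (_ : NumberField K), IsImaginaryQuadratic K ∧ NumberField.discr K = -8 := by
  refine exists_isImaginaryQuadratic_discr_eq (by norm_num) ?_
  exact Or.inr ⟨by norm_num, by norm_num, Int.squarefree_natAbs.mp (by decide +kernel)⟩

/-- An imaginary quadratic field of discriminant `-23` exists (as a `Type`). [cite: Marcus1977, Ch. 2 Thm. 1] -/
theorem exists_field_neg23 :
    ∃ (K : Type) (_ : Field K) (_ : NumberField K), IsImaginaryQuadratic K ∧ NumberField.discr K = -23 := by
  refine exists_isImaginaryQuadratic_discr_eq (by norm_num) ?_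
  exact Or.inl ⟨by norm_num, Int.squarefree_natAbs.mp (by decide +kernel), by norm_num⟩

/-- An imaginary quadratic field of discriminant `-51` exists (as a `Type`). [cite: Marcus1977, Ch. 2 Thm. 1] -/
theorem exists_field_neg51 :
    ∃ (K : Type) (_ : Field K) (_ : NumberField K), IsImaginaryQuadratic K ∧ NumberField.discr K = -51 := by
  refine exists_isImaginaryQuadratic_discr_eq (by norm_num) ?_
  exact Or.inl ⟨by norm_num, Int.squarefree_natAbs.mp (by decide +kernel), by norm_num⟩

/-- An imaginary quadratic field of discriminant `-39` exists (as a `Type`). [cite: Marcus1977, Ch. 2 Thm. 1] -/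
theorem exists_field_neg39 :
    ∃ (K : Type) (_ : Field K) (_ : NumberField K), IsImaginaryQuadratic K ∧ NumberField.discr K = -39 := by
  refine exists_isImaginaryQuadratic_discr_eq (by norm_num) ?_
  exact Or.inl ⟨by norm_num, Int.squarefree_natAbs.mp (by decide +kernel), by norm_num⟩

/-- An imaginary quadratic field of discriminant `-83` exists (as a `Type`). [cite: Marcus1977, Ch. 2 Thm. 1] -/
theorem exists_field_neg83 :
    ∃ (K : Type) (_ : Field K) (_ : NumberField K), IsImaginaryQuadratic K ∧ NumberField.discr K = -83 := by
  refine exists_isImaginaryQuadratic_discr_eq (by norm_num) ?_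
  exact Or.inl ⟨by norm_num, Int.squarefree_natAbs.mp (by decide +kernel), by norm_num⟩

/-- An imaginary quadratic field of discriminant `-19` exists (as a `Type`). [cite: Marcus1977, Ch. 2 Thm. 1] -/
theorem exists_field_neg19 :
    ∃ (K : Type) (_ : Field K) (_ : NumberField K), IsImaginaryQuadratic K ∧ NumberField.discr K = -19 := by
  refine exists_isImaginaryQuadratic_discr_eq (by norm_num) ?_
  exact Or.inl ⟨by norm_num, Int.squarefree_natAbs.mp (by decide +kernel), by norm_num⟩

/-- An imaginary quadratic field of discriminant `-111` exists (as a `Type`). [cite: Marcus1977, Ch. 2 Thm. 1] -/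
theorem exists_field_neg111 :
    ∃ (K : Type) (_ : Field K) (_ : NumberField K), IsImaginaryQuadratic K ∧ NumberField.discr K = -111 := by
  refine exists_isImaginaryQuadratic_discr_eq (by norm_num) ?_
  exact Or.inl ⟨by norm_num, Int.squarefree_natAbs.mp (by decide +kernel), by norm_num⟩

/-- An imaginary quadratic field of discriminant `-31` exists (as a `Type`). [cite: Marcus1977, Ch. 2 Thm. 1] -/
theorem exists_field_neg31 :
    ∃ (K : Type) (_ : Field K) (_ : NumberField K), IsImaginaryQuadratic K ∧ NumberField.discr K = -31 := by
  refine exists_isImaginaryQuadratic_discr_eq (by norm_num) ?_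
  exact Or.inl ⟨by norm_num, Int.squarefree_natAbs.mp (by decide +kernel), by norm_num⟩

/-- An imaginary quadratic field of discriminant `-52` exists (as a `Type`). [cite: Marcus1977, Ch. 2 Thm. 1] -/
theorem exists_field_neg52 :
    ∃ (K : Type) (_ : Field K) (_ : NumberField K), IsImaginaryQuadratic K ∧ NumberField.discr K = -52 := by
  refine exists_isImaginaryQuadratic_discr_eq (by norm_num) ?_
  exact Or.inr ⟨by norm_num, by norm_num, Int.squarefree_natAbs.mp (by decide +kernel)⟩

/-- An imaginary quadratic field of discriminant `-67` exists (as a `Type`). [cite: Marcus1977, Ch. 2 Thm. 1] -/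
theorem exists_field_neg67 :
    ∃ (K : Type) (_ : Field K) (_ : NumberField K), IsImaginaryQuadratic K ∧ NumberField.discr K = -67 := by
  refine exists_isImaginaryQuadratic_discr_eq (by norm_num) ?_
  exact Or.inl ⟨by norm_num, Int.squarefree_natAbs.mp (by decide +kernel), by norm_num⟩

end Summit.BirchSwinnertonDyer.BirchSwinnertonDyer.Theorems.KolyvaginDepthDoor

end
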